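import Mathlib
import Summits.Ventures.HodgeRepro2.T5AdicCompletionRamified
import Summits.Ventures.HodgeRepro2.T5AdicCompletionConductor
import Summits.Ventures.HodgeRepro2.T5AdicCompletionHenselian
import Summits.Ventures.HodgeRepro2.T5AdicCompletionNormSurjective
import Summits.Ventures.HodgeRepro2.T5AdicCompletionNormGroup
import Summits.Ventures.HodgeRepro2.T5LocalNormCharacter
import Summits.Ventures.HodgeRepro2.T5ContinuousValuationExtension
import Summits.Ventures.HodgeRepro2.T5LocalFieldUnitsDecomposition
import Summits.Ventures.HodgeRepro2.T5RamifiedCharacterCount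
import Summits.Ventures.HodgeRepro2.T5ConductorArithmetic
import Summits.Ventures.HodgeRepro2.T6N5LocalInertCompletion

/-!
# T6N5LocalRamCompletion — Tier 6, M2 sub-step N5 (t6-p8's half): the character-side datum conditions of the
RAMIFIED local sign datum on Mathlib's adic completions, PROVED from p4's accepted kernel

Layer III for t6-p8's ramified datum conditions (`T6N5LocalRam.N5Local_main_ramified`), on Mathlib's completions
`K_v ⊆ L_w` (`[w.asIdeal.LiesOver v.asIdeal]`, `[L_w : K_v] = 2`, `ϖ` a uniformiser of `K_v` NOT irreducible in
`O_{L_w}` — p4's ramified setting `T5AdicCompletionRamified`, `π` a uniformiser of `L_w`). The carriers are those of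
`T6N5LocalInertCompletion` (`E := L_w^×`, `F_v^× := range (baseUnits v w)`, `μ := (−1)^{v_{L_w}(·)}`, `ηF` := p4's
norm character on `F_v^×`) with the filtration `Uπ n := image of U_{L_w}^n = higherUnits π n`.
* `Uπ_antitone` — the datum condition `hU`.
* `μ_mem_Uπ_zero`, `μ_uniformizer`, `μ_isCO`, `μ_sq` — the datum condition `hμ` of `N5Local_main_ramified`: `μ` is
  unramified, `μ(π) = −1`, conjugate-orthogonal (`v_{L_w}(algebraMap y) = 2 v_{K_v}(y)`: the valuation of `ϖ` is
  `exp(−2)` in `L_w`, p4's `val_algebraMap_eq_exp_neg_two`) and `μ² = 1`.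
* `exists_CO_exact_even_level` — the datum condition `heven`: conjugate-orthogonal characters of every even
  conductor `2k + 2` (p4's `exists_character_trivial_on_exact_even_level_of_quadratic_ramified`, N5.L4 (iv-b)).
* `exists_CS_odd_level` — the datum condition `hodd` at a TAME place (`2` a unit of `O_{K_v}`): a
  conjugate-symplectic character `ω̃` of conductor exactly `1` — the extension of `η_v` (p4's `normChar`, trivial on
  `1 + 𝔪_{K_v}` at a tame place: `normChar_eq_one_of_val_sub_one_lt_one`) from `F_v^×` to `L_w^×` trivial on
  `U_{L_w}^1` (p4's `exists_extension_trivial_on_higherUnits_odd_of_quadratic_ramified` at `t = 0`, N5.L4 (iv-a)),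
  non-trivial on the units because `η_v` is (p4's `exists_units_normChar_eq_neg_one`). The wild case
  (`2 ∈ 𝔪_{K_v}`) stays a datum condition.
The Tate side (`Psi`, `Meas`, `epsT`, `ψ_δ`, `n(ψ)`, `IsConjInv`) has no Mathlib model and stays the lead's parameters.
README §8(d): uses an L-value-free non-vanishing device: NO.
-/

namespace Summit.Ventures.HodgeRepro2.T6.N5LocalRamCompletion

open Summit.Ventures.HodgeRepro2 IsDedekindDomain HeightOneSpectrum
  Summit.Ventures.HodgeRepro2.T5ConductorArithmetic Summit.Ventures.HodgeRepro2.T6.N5LocalInertCompletion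

variable {K : Type*} [Field K] [NumberField K] (v : HeightOneSpectrum (NumberField.RingOfIntegers K))
  {L : Type*} [Field L] [NumberField L] [Algebra K L] (w : HeightOneSpectrum (NumberField.RingOfIntegers L))
  [w.asIdeal.LiesOver v.asIdeal]
  [ContinuousSMul (v.adicCompletion K) (w.adicCompletion L)]
  [IsScalarTower K (v.adicCompletion K) (w.adicCompletion L)]

noncomputable section

/-! ### `ℂˣ` is divisible (needed by p4's extension lemma) -/

omit [Algebra K L] [w.asIdeal.LiesOver v.asIdeal] [ContinuousSMul (v.adicCompletion K) (w.adicCompletion L)]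
  [IsScalarTower K (v.adicCompletion K) (w.adicCompletion L)] in
/-- Every `n`-th root exists in `ℂˣ` (`ℂ` is algebraically closed). -/
theorem pow_surjective_units_complex {n : ℕ} (hn : n ≠ 0) :
    Function.Surjective (fun a : ℂˣ => a ^ n) := by
  intro u
  obtain ⟨z, hz⟩ := IsAlgClosed.exists_pow_nat_eq (u : ℂ) (Nat.pos_of_ne_zero hn)
  have hz0 : z ≠ 0 := by
    intro h
    rw [h, zero_pow hn] at hz
    exact u.ne_zero hz.symm
  refine ⟨Units.mk0 z hz0, Units.ext ?_⟩
  simp [hz]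

/-- `ℂˣ` is `ℕ`-rootable. -/
@[reducible] def rootableByNat : RootableBy ℂˣ ℕ :=
  rootableByOfPowLeftSurj ℂˣ ℕ (fun hn => pow_surjective_units_complex hn)

/-- `ℂˣ` is `ℤ`-rootable (divisible). -/
@[reducible] def rootableByInt : RootableBy ℂˣ ℤ :=
  @Group.rootableByIntOfRootableByNat ℂˣ _ rootableByNat

/-! ### The filtration by the uniformiser of `L_w` -/

/-- The principal-unit filtration of `L_w^×` at a uniformiser `π` of `L_w`: the image of p4's `higherUnits π n`
(`Uπ 0 = O_{L_w}^×`, `Uπ n = 1 + P_{L_w}^n`). -/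
def Uπ (π : w.adicCompletionIntegers L) (n : ℕ) : Subgroup (w.adicCompletion L)ˣ :=
  Subgroup.map (intUnits w) (T5PrincipalUnitFiltration.higherUnits π n)

omit [Algebra K L] [w.asIdeal.LiesOver v.asIdeal] [ContinuousSMul (v.adicCompletion K) (w.adicCompletion L)]
  [IsScalarTower K (v.adicCompletion K) (w.adicCompletion L)] in
/-- The datum condition `hU`: the filtration is antitone. -/
theorem Uπ_antitone (π : w.adicCompletionIntegers L) : Antitone (Uπ w π) := fun _ _ hmn =>
  Subgroup.map_mono (T5PrincipalUnitFiltration.higherUnits_antitone _ hmn)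

omit [Algebra K L] [w.asIdeal.LiesOver v.asIdeal] [ContinuousSMul (v.adicCompletion K) (w.adicCompletion L)]
  [IsScalarTower K (v.adicCompletion K) (w.adicCompletion L)] in
/-- `μ` is unramified: trivial on `Uπ 0 = O_{L_w}^×`. -/
theorem μ_mem_Uπ_zero (π : w.adicCompletionIntegers L) : Uπ w π 0 ≤ (μ w).ker := by
  rintro x ⟨u, -, rfl⟩
  rw [MonoidHom.mem_ker, μ_apply]
  show (-1 : ℂˣ) ^ (Valued.v ((u : w.adicCompletionIntegers L) : w.adicCompletion L)).log = 1
  rw [T5AdicCompletionNormSurjective.val_coe_units_eq_one w u, WithZero.log_one, zpow_zero]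

omit [Algebra K L] [w.asIdeal.LiesOver v.asIdeal] [ContinuousSMul (v.adicCompletion K) (w.adicCompletion L)]
  [IsScalarTower K (v.adicCompletion K) (w.adicCompletion L)] in
/-- `μ(π) = −1` for a uniformiser `π` of `L_w` (`v(π) = exp(−1)`). -/
theorem μ_uniformizer {π : w.adicCompletionIntegers L} (hπ : Irreducible π) :
    μ w (T5LocalFieldUnitsDecomposition.uniformizerUnit π hπ) = -1 := by
  rw [μ_apply]
  have hv : Valued.v ((T5LocalFieldUnitsDecomposition.uniformizerUnit π hπ : (w.adicCompletion L)ˣ) :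
      w.adicCompletion L) = WithZero.exp (-1) :=
    (T5AdicCompletionConductor.irreducible_iff_val_eq_exp_neg_one w π).mp hπ
  rw [hv, WithZero.log_exp]
  have h : (-1 : ℂˣ) ^ (-1 : ℤ) = -1 := (by decide : Odd (-1 : ℤ)).neg_one_zpow
  exact h

omit [Algebra K L] [w.asIdeal.LiesOver v.asIdeal] [ContinuousSMul (v.adicCompletion K) (w.adicCompletion L)]
  [IsScalarTower K (v.adicCompletion K) (w.adicCompletion L)] in
/-- `μ² = 1`. -/
theorem μ_sq : μ w * μ w = 1 := by
  ext x
  rw [MonoidHom.mul_apply, MonoidHom.one_apply, μ_apply, ← zpow_add, ← two_mul]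
  have h : (-1 : ℂˣ) ^ (2 * (Valued.v (x : w.adicCompletion L)).log) = 1 := (even_two_mul _).neg_one_zpow
  rw [h]

omit [IsScalarTower K (v.adicCompletion K) (w.adicCompletion L)] in
/-- The datum condition `hμ` (conjugate-orthogonality): `μ` is trivial on `F_v^×` at a ramified place, since
`v_{L_w}(algebraMap y) = 2 v_{K_v}(y)` (`y = u ϖ^k` with `u` a unit: `v_{L_w}(ϖ) = exp(−2)`). -/
theorem μ_isCO (h2 : Module.finrank (v.adicCompletion K) (w.adicCompletion L) = 2)
    {ϖ : v.adicCompletionIntegers K} (hϖ : Irreducible ϖ) {π : w.adicCompletionIntegers L} (hπ : Irreducible π)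
    (hram : ¬ Irreducible (algebraMap (v.adicCompletionIntegers K) (w.adicCompletionIntegers L) ϖ)) :
    ∀ f ∈ Fsub v w, μ w f = 1 := by
  rintro f ⟨y, rfl⟩
  rw [μ_apply]
  obtain ⟨u, k, hk⟩ := T5LocalFieldUnitsDecomposition.exists_unit_mul_zpow ϖ hϖ (y : v.adicCompletion K)
    y.ne_zero
  have hϖv : Valued.v ((algebraMap (v.adicCompletion K) (w.adicCompletion L))
      ((algebraMap (v.adicCompletionIntegers K) (v.adicCompletion K)) ϖ)) = WithZero.exp (-2) :=
    T5RamifiedCharacterCount.val_algebraMap_eq_exp_neg_two v w h2 hϖ hπ hram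
  have hu : Valued.v ((algebraMap (v.adicCompletion K) (w.adicCompletion L))
      ((algebraMap (v.adicCompletionIntegers K) (v.adicCompletion K)) (u : v.adicCompletionIntegers K))) = 1 :=
    (T5ContinuousValuationExtension.val_algebraMap_eq_one_iff _).mpr
      (T5AdicCompletionNormSurjective.val_coe_units_eq_one v u)
  have hvy : Valued.v ((T5UnramifiedCharacter.baseUnits v w y : (w.adicCompletion L)ˣ) : w.adicCompletion L) =
      WithZero.exp (-(2 * k)) := by
    show Valued.v ((algebraMap (v.adicCompletion K) (w.adicCompletion L)) (y : v.adicCompletion K)) = _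
    rw [hk, map_mul, map_zpow₀, map_mul, map_zpow₀, hϖv, hu, one_mul, ← WithZero.exp_zsmul, smul_eq_mul,
      mul_neg, mul_comm]
  rw [hvy, WithZero.log_exp]
  exact (even_two_mul k).neg.neg_one_zpow

/-! ### The datum condition `heven`: conjugate-orthogonal characters of every even conductor -/

/-- For every `k` a character `β` of `L_w^×` trivial on `F_v^×`, smooth, of exact conductor `2k + 2` for `Uπ`
(p4's `exists_character_trivial_on_exact_even_level_of_quadratic_ramified`). -/
theorem exists_CO_exact_even_level (h2 : Module.finrank (v.adicCompletion K) (w.adicCompletion L) = 2)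
    {ϖ : v.adicCompletionIntegers K} (hϖ : Irreducible ϖ) {π : w.adicCompletionIntegers L} (hπ : Irreducible π)
    (hram : ¬ Irreducible (algebraMap (v.adicCompletionIntegers K) (w.adicCompletionIntegers L) ϖ)) (k : ℕ) :
    ∃ β : (w.adicCompletion L)ˣ →* ℂˣ, (∀ f ∈ Fsub v w, β f = 1) ∧
      (∃ m, Uπ w π m ≤ β.ker) ∧ conductor (Uπ w π) β = 2 * k + 2 := by
  obtain ⟨χ', hF, h1, u, hu, hu1⟩ :=
    T5AdicCompletionRamified.exists_character_trivial_on_exact_even_level_of_quadratic_ramified v w h2 hϖ hπ hram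
      (Fsub v w) (fun s hs => exists_unitsMap_eq_of_mem_Fsub v w s hs) k
  have hle : Uπ w π (2 * k + 2) ≤ χ'.ker := by
    rintro x ⟨u', hu', rfl⟩
    exact MonoidHom.mem_ker.mpr (h1 u' hu')
  have hnle : ¬ Uπ w π (2 * k + 1) ≤ χ'.ker := by
    intro h
    have hmem : intUnits w u ∈ Uπ w π (2 * k + 1) := ⟨u, hu, rfl⟩
    exact hu1 (MonoidHom.mem_ker.mp (h hmem))
  refine ⟨χ', hF, ⟨2 * k + 2, hle⟩, ?_⟩
  have hc1 : conductor (Uπ w π) χ' ≤ 2 * k + 2 := conductor_le_of_le_ker hle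
  have hc2 : ¬ conductor (Uπ w π) χ' ≤ 2 * k + 1 := fun h =>
    hnle (le_ker_of_conductor_le (Uπ_antitone w π) ⟨2 * k + 2, hle⟩ h)
  omega

/-! ### The datum condition `hodd` at a tame place: a conjugate-symplectic character of conductor `1` -/

omit [IsScalarTower K (v.adicCompletion K) (w.adicCompletion L)] in
/-- A unit `y` of `K_v` (valuation one) lies in `Uπ 0` after `baseUnits`: it is the image of an integer unit. -/
theorem baseUnits_mem_Uπ_zero (π : w.adicCompletionIntegers L) (y : (v.adicCompletion K)ˣ)
    (hy : Valued.v (y : v.adicCompletion K) = 1) :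
    T5UnramifiedCharacter.baseUnits v w y ∈ Uπ w π 0 := by
  have hmem : T5UnramifiedCharacter.baseUnits v w y ∈ (T5UnramifiedCharacter.baseUnits v w).range ⊓
      Valued.v.valuationSubring.unitGroup :=
    Subgroup.mem_inf.mpr ⟨⟨y, rfl⟩, (Valuation.mem_unitGroup_iff _ _ _).mpr
      ((T5ContinuousValuationExtension.val_algebraMap_eq_one_iff _).mpr hy)⟩
  rw [T5AdicCompletionUnitIndex.range_baseUnits_inf_unitGroup v w] at hmem
  obtain ⟨s, -, hs⟩ := hmem
  refine ⟨s, ?_, hs⟩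
  show s ∈ T5PrincipalUnitFiltration.higherUnits π 0
  rw [T5PrincipalUnitFiltration.mem_higherUnits, pow_zero]
  exact one_dvd _

/-- The datum condition `hodd` at a TAME ramified place: a character `ω̃` of `L_w^×` that agrees with `η_v`
(`ηF`, p4's norm character) on `F_v^×` — conjugate-symplectic — is smooth and has conductor exactly `1`:
p4's `exists_extension_trivial_on_higherUnits_odd_of_quadratic_ramified` at `t = 0` (the extension exists because
`η_v` is trivial on `1 + 𝔪_{K_v}` at a tame place, `normChar_eq_one_of_val_sub_one_lt_one`), non-trivial on the
units because `η_v` is (`exists_units_normChar_eq_neg_one`). -/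
theorem exists_CS_odd_level (h2 : Module.finrank (v.adicCompletion K) (w.adicCompletion L) = 2)
    {ϖ : v.adicCompletionIntegers K} (hϖ : Irreducible ϖ) {π : w.adicCompletionIntegers L} (hπ : Irreducible π)
    (hram : ¬ Irreducible (algebraMap (v.adicCompletionIntegers K) (w.adicCompletionIntegers L) ϖ))
    (σ : Gal(w.adicCompletion L/v.adicCompletion K)) (hσ : σ ≠ 1) (h2u : IsUnit (2 : v.adicCompletionIntegers K))
    (hind : (T5AdicCompletionNormGroup.normGroup v w σ).index = 2) :
    ∃ ω : (w.adicCompletion L)ˣ →* ℂˣ, (∀ f : Fsub v w, ω f = ηF v w σ hind f) ∧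
      (∃ m, Uπ w π m ≤ ω.ker) ∧ conductor (Uπ w π) ω = 1 := by
  haveI : RootableBy ℂˣ ℤ := rootableByInt
  -- the extension from `F_v^× U^1`: `η_v` is trivial on the principal units of `K_v` at a tame place
  have hη : ∀ (r : (v.adicCompletionIntegers K)ˣ)
      (h : intUnits w (T5PrincipalUnitComparison.unitsMap r) ∈ Fsub v w),
      r ∈ T5PrincipalUnitFiltration.higherUnits ϖ (0 + 1) →
      ηF v w σ hind ⟨intUnits w (T5PrincipalUnitComparison.unitsMap r), h⟩ = 1 := by
    intro r h hr
    set y : (v.adicCompletion K)ˣ := Units.map (algebraMap (v.adicCompletionIntegers K)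
      (v.adicCompletion K)).toMonoidHom r with hy
    have hfe : (⟨intUnits w (T5PrincipalUnitComparison.unitsMap r), h⟩ : Fsub v w) =
        ⟨T5UnramifiedCharacter.baseUnits v w y, ⟨y, rfl⟩⟩ := by
      apply Subtype.ext
      apply Units.ext
      show (algebraMap (w.adicCompletionIntegers L) (w.adicCompletion L))
          (algebraMap (v.adicCompletionIntegers K) (w.adicCompletionIntegers L) (r : v.adicCompletionIntegers K)) =
        (algebraMap (v.adicCompletion K) (w.adicCompletion L))
          (algebraMap (v.adicCompletionIntegers K) (v.adicCompletion K) (r : v.adicCompletionIntegers K))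
      rw [← IsScalarTower.algebraMap_apply, ← IsScalarTower.algebraMap_apply]
    rw [hfe, ηF_baseUnits]
    have hyv : Valued.v (y : v.adicCompletion K) = 1 :=
      T5AdicCompletionNormSurjective.val_coe_units_eq_one v r
    have hyv1 : Valued.v ((y : v.adicCompletion K) - 1) < 1 := by
      have h1 : ϖ ^ 1 ∣ (r : v.adicCompletionIntegers K) - 1 := by
        rw [T5PrincipalUnitFiltration.mem_higherUnits] at hr
        simpa using hr
      have hle := (T5AdicCompletionHenselian.pow_dvd_iff_val_le v hϖ _ 1).mp h1
      have hlt : WithZero.exp (-((1 : ℕ) : ℤ)) < (1 : WithZero (Multiplicative ℤ)) := by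
        rw [← WithZero.exp_zero]
        exact WithZero.exp_lt_exp.mpr (by norm_num)
      have hcast : Valued.v ((y : v.adicCompletion K) - 1) =
          Valued.v (((r : v.adicCompletionIntegers K) - 1 : v.adicCompletionIntegers K) : v.adicCompletion K) := by
        congr 1
      rw [hcast]
      exact lt_of_le_of_lt hle hlt
    rw [T5LocalNormCharacter.normChar_eq_one_of_val_sub_one_lt_one v w σ hind h2 hϖ hπ hram hσ h2u y hyv hyv1,
      map_one]
  obtain ⟨ω, hωF, hω1⟩ :=
    T5AdicCompletionRamified.exists_extension_trivial_on_higherUnits_odd_of_quadratic_ramified v w h2 hϖ hπ hram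
      (Fsub v w) (fun s hs => exists_unitsMap_eq_of_mem_Fsub v w s hs) (ηF v w σ hind) 0 hη
  have hle : Uπ w π 1 ≤ ω.ker := by
    rintro x ⟨u', hu', rfl⟩
    have := hω1 u' (by simpa using hu')
    exact MonoidHom.mem_ker.mpr this
  -- non-trivial on the units: `η_v(u) = −1` for some unit `u` of `K_v`
  obtain ⟨u, hu1, hu⟩ :=
    T5LocalNormCharacter.exists_units_normChar_eq_neg_one v w σ hind h2 hϖ hπ hram hσ h2u
  have hnle : ¬ Uπ w π 0 ≤ ω.ker := by
    intro h
    have hmem := h (baseUnits_mem_Uπ_zero v w π u hu1)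
    rw [MonoidHom.mem_ker] at hmem
    have hval : ω (T5UnramifiedCharacter.baseUnits v w u) = Units.map (Int.castRingHom ℂ).toMonoidHom (-1 : ℤˣ) := by
      rw [← hu, ← ηF_baseUnits v w σ hind u]
      exact hωF ⟨T5UnramifiedCharacter.baseUnits v w u, ⟨u, rfl⟩⟩
    rw [hval] at hmem
    have : ((Units.map (Int.castRingHom ℂ).toMonoidHom (-1 : ℤˣ) : ℂˣ) : ℂ) = 1 := by rw [hmem]; rfl
    simp at this
    norm_num at this
  refine ⟨ω, hωF, ⟨1, hle⟩, ?_⟩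
  have hc1 : conductor (Uπ w π) ω ≤ 1 := conductor_le_of_le_ker hle
  have hc2 : ¬ conductor (Uπ w π) ω ≤ 0 := fun h =>
    hnle (le_ker_of_conductor_le (Uπ_antitone w π) ⟨1, hle⟩ h)
  omega

end

end Summit.Ventures.HodgeRepro2.T6.N5LocalRamCompletion
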